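import Summits.QuantumFields.YangMills.Theorems.InfiniteVolumeContinuumIVData
import Summits.QuantumFields.YangMills.Theorems.InfiniteVolumeContinuumIVReflectionPositivity
import Summits.QuantumFields.YangMills.Theorems.InfiniteVolumeContinuumIVEuclideanInvariance
import Summits.QuantumFields.YangMills.Theorems.InfiniteVolumeContinuumAssembly
import HarnessLib

/-!
# Route `InfiniteVolumeContinuum`: the target `OSExistenceFromInfiniteVolume` (stmt-QuantumFields-19927) from the three
# cruxes alone (CONDITIONAL RESULT)

Lead seat `ym-infvol-p1` (R136 (i)).  HONEST FRAMING: a CONDITIONAL result — the three cruxes of the route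
(`UVCond := BalabanLadder.UV`, `SeamRec := BalabanLadder.UVSeamRec`, `Rot := BalabanLadder.ROT`, the spine's legs BY NAME)
are OPEN and appear as hypotheses; the three supports are discharged by the landed theorems `IVData_holds` (seat p2),
`IVReflectionPositivity_holds` (seat p3), `IVEuclideanInvariance_proof` (this seat with p2/p3's stubs); the conclusion is the
EXISTENCE HALF only (OS data E0–E3 + E0′, nontrivial, non-Gaussian, for the infinite-volume-first continuum limit); no
mass gap, not Clay.

REV 1 (planner g3 decision (iv), 2026-08-26T23:34Z; re-land by seat ym-infvol-p2 g3, 2026-08-27): the route's deciding theorem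
`closes` now has FOUR binders and concludes the re-typed leaf `HypercubicOSDataFromInfiniteVolume` (stmt-QuantumFields-19868; exact
hyperoctahedral W₄ invariance in place of E1).  The rev-0 corollary `OSExistenceFromInfiniteVolume_of_legs` (three legs ⇒ old leaf,
now an aside) is KEPT with its statement and re-proved over the closes-independent `Assembly_proof` (p475534); the rev-1 corollary
`HypercubicOSDataFromInfiniteVolume_of_legs` (TWO legs ⇒ new leaf) is appended.  Both remain conditional: `UVCond`, `SeamRec`
(and `Rot` for the first) are open spine legs.
-/

set_option autoImplicit false

namespace Summit.QuantumFields.YangMills.Theorems.InfiniteVolumeContinuum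

open Summit.QuantumFields.YangMills.Theses.InfiniteVolumeContinuum

/-- **The rev-0 target from the three legs** (kept; now an aside of the route): `UVCond → SeamRec → Rot →
OSExistenceFromInfiniteVolume`, via the closes-independent `Assembly_proof` with the three support hypotheses discharged by name.
[folklore] -/
theorem OSExistenceFromInfiniteVolume_of_legs (hUV : UVCond) (hSeam : SeamRec) (hROT : Rot) :
    OSExistenceFromInfiniteVolume :=
  Assembly_proof hUV hSeam hROT IVData_holds IVReflectionPositivity_holds
    Summit.QuantumFields.YangMills.Theorems.InfiniteVolume.E1.IVEuclideanInvariance_proof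

/-- **The rev-1 target from the two legs**: `UVCond → SeamRec → HypercubicOSDataFromInfiniteVolume` — the route's 4-binder deciding
theorem `closes` with its two support hypotheses discharged by name (`IVData_holds`, `IVReflectionPositivity_holds`).  CONDITIONAL:
both cruxes are open spine legs (Track A's `UV`, the seam `UVSeamRec`). [folklore] -/
theorem HypercubicOSDataFromInfiniteVolume_of_legs (hUV : UVCond) (hSeam : SeamRec) :
    HypercubicOSDataFromInfiniteVolume :=
  closes hUV hSeam IVData_holds IVReflectionPositivity_holds

end Summit.QuantumFields.YangMills.Theorems.InfiniteVolumeContinuum
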